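import Summits.BirchSwinnertonDyer.BirchSwinnertonDyer.Theorems.PrintCf2DisegniPairTwoTwistScaling
import Literature.NumberTheory.EllipticCurves.BSDQuadraticDescentPeriodEliminationProofs
import Literature.NumberTheory.EllipticCurves.ComplexMultiplicationTwistIsogenyProofs
import HarnessLib

/-!
# Road (C) `disegni-pair-two` on crux stmt-BirchSwinnertonDyer-20368 — the archimedean class constant
# `c_∞(V) = 1` of the odd classes, DISCHARGED for every twist of a base curve of negative discriminant

Cell `bsd-print-cf2`, width seat `bsd-line-cf2-p1-w8` g24; sequel of `PrintCf2DisegniPairTwoTwistScaling.lean`.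
`--supports stmt-BirchSwinnertonDyer-20368` (helper). THEOREMS ONLY (no `def`, no named fact, no `sorry`);
conditional on every displayed hypothesis. BSD is not proved by any of this; no summit statement is claimed;
20368 is not closed here.

## What is proved

The odd-class compositions `defectKey_chi4_modulo_descent_min` / `defectKey_chi8'_modulo_descent_min` carry the
term `v₂(c_∞(V))`, `c_∞(V) = #π₀(V(ℝ)) = (V.baseChange ℝ).numRealComponents` (Pal's archimedean step for a NEGATIVE
twist reads the real period of the twist on `c_∞(V)·|Ω⁻(V)|`). For the road's good curves `V` — globally minimal
models of quadratic twists `E^{(d)}` of a base curve `E` with `Δ(E) < 0` (for the crux: `E = cm7 = 49a1`,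
`Δ = −7³`) — this constant is `1`:

* §1 `numRealComponents_eq_one_of_Δ_neg` (`Δ(V) < 0 ⇒ c_∞(V) = 1`, Cremona §3.7),
  `Δ_neg_of_smul_eq_quadraticTwist` (`Δ(C • E^{(d)}) = u⁻¹² d⁶ Δ(E)` has the sign of `Δ(E)`),
  `numRealComponents_eq_one_of_smul_eq_quadraticTwist`, and the `cm7` instance
  `numRealComponents_eq_one_of_smul_eq_quadraticTwist_cm7` (`Δ(cm7) = −7³`, tree `Δ_cm7`).
* §2 ★★★ `defectKey_chi4_modulo_descent_min_of_Δ_neg`, ★★★ `defectKey_chi8'_modulo_descent_min_of_Δ_neg`: the odd-class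
  defect keys MODULO (Δ1) for a globally minimal member with `Δ(V) < 0`, the `c_∞` term GONE:
  `v₂(q) + v₂(Tam W) + v₂(h₂) = v₂(D) + 2 + 2v₂(#W(ℚ)_tors) + v₂(μ)`.

References: J. E. Cremona, *Algorithms for Modular Elliptic Curves* (1997) §3.7 [CremonaAlgorithms1997]; V. Pal,
Proc. AMS 140 (2012) Thm. 3.2 (case `d < 0`) [Pal2012]; D. Disegni, Compos. Math. 153 (2017) Thm. B [Disegni2017];
J. H. Silverman, AEC (2009) III.1 Table 3.1 [SilvermanAEC2009].
-/

set_option autoImplicit false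
set_option linter.dupNamespace false

noncomputable section

open scoped Classical MatrixGroups ModularForm NumberField

open CongruenceSubgroup NumberField IsDedekindDomain WeierstrassCurve WeierstrassCurve.Affine.Point
  Literature.NumberTheory.EllipticCurves Literature.NumberTheory.EllipticCurves.ModularForms
  Literature.NumberTheory.EllipticCurves.Disegni2017 Literature.NumberTheory.GaloisRepresentations
  Summit.BirchSwinnertonDyer.Rank1Residual.AdditivePotMult

namespace Summit.BirchSwinnertonDyer.BirchSwinnertonDyer.Theorems.PrintCf2.DisegniPairTwo

/-! ### §1 One real component for negative discriminant, and its transport along twists -/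

section Components

/-- **`Δ(V) < 0 ⇒ c_∞(V) = 1`**: a real Weierstrass equation with negative discriminant has one real component
(`numRealComponents` of the base change to `ℝ`). [cite: CremonaAlgorithms1997, §3.7] -/
theorem numRealComponents_eq_one_of_Δ_neg (V : WeierstrassCurve ℚ) (hΔ : V.Δ < 0) :
    (V.baseChange ℝ).numRealComponents = 1 := by
  rw [numRealComponents_baseChange_real, if_neg (not_lt.mpr hΔ.le)]

/-- **The sign of the discriminant is constant on a quadratic-twist class**: `Δ(C • E^{(d)}) = u(C)⁻¹² · d⁶ · Δ(E)`
(`quadraticTwist_Δ`, `variableChange_Δ`), so `Δ(E) < 0 ⇒ Δ(V) < 0` for every model `V = C • E^{(d)}`, `d ≠ 0`.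
[cite: SilvermanAEC2009, III.1 Table 3.1] -/
theorem Δ_neg_of_smul_eq_quadraticTwist (E V : WeierstrassCurve ℚ) (hE : E.Δ < 0) {d : ℚ} (hd : d ≠ 0)
    {C : VariableChange ℚ} (hC : C • E.quadraticTwist d = V) : V.Δ < 0 := by
  rw [← hC, variableChange_Δ, quadraticTwist_Δ]
  have h1 : (0 : ℚ) < ((C.u⁻¹ : ℚˣ) : ℚ) ^ 12 := Even.pow_pos (by decide) (Units.ne_zero _)
  have h2 : (0 : ℚ) < d ^ 6 := Even.pow_pos (by decide) hd
  have h3 : d ^ 6 * E.Δ < 0 := mul_neg_of_pos_of_neg h2 hE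
  exact mul_neg_of_pos_of_neg h1 h3

/-- **`c_∞(V) = 1` for every model of a quadratic twist of a base curve with `Δ(E) < 0`.**
[cite: CremonaAlgorithms1997, §3.7] [cite: SilvermanAEC2009, III.1 Table 3.1] -/
theorem numRealComponents_eq_one_of_smul_eq_quadraticTwist (E V : WeierstrassCurve ℚ) (hE : E.Δ < 0) {d : ℚ}
    (hd : d ≠ 0) {C : VariableChange ℚ} (hC : C • E.quadraticTwist d = V) :
    (V.baseChange ℝ).numRealComponents = 1 :=
  numRealComponents_eq_one_of_Δ_neg V (Δ_neg_of_smul_eq_quadraticTwist E V hE hd hC)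

/-- **The crux's base curve**: every model `V = C • cm7^{(d)}` (`d ≠ 0`) of a quadratic twist of `cm7 = 49a1`
(`Δ(cm7) = −7³`, tree `Δ_cm7`) has `c_∞(V) = 1`. [cite: CremonaAlgorithms1997, §3.7 and Table 1 (49a1)] -/
theorem numRealComponents_eq_one_of_smul_eq_quadraticTwist_cm7 (V : WeierstrassCurve ℚ) {d : ℚ} (hd : d ≠ 0)
    {C : VariableChange ℚ} (hC : C • cm7.quadraticTwist d = V) : (V.baseChange ℝ).numRealComponents = 1 :=
  numRealComponents_eq_one_of_smul_eq_quadraticTwist cm7 V (by rw [Δ_cm7]; norm_num) hd hC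

/-- `v₂(c_∞(V)) = 0` when `Δ(V) < 0` (the valuation form consumed by the defect keys). [cite: CremonaAlgorithms1997, §3.7] -/
theorem padicValNat_numRealComponents_eq_zero_of_Δ_neg (V : WeierstrassCurve ℚ) (hΔ : V.Δ < 0) :
    padicValNat 2 (V.baseChange ℝ).numRealComponents = 0 := by
  rw [numRealComponents_eq_one_of_Δ_neg V hΔ]
  simp

end Components

variable (ι : PadicAlgCl 2 ≃+* ℂ) (K : Type) [Field K] [NumberField K] [IsGalois ℚ K]

/-! ### §2 The odd-class defect keys MODULO (Δ1), `c_∞` discharged -/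

/-- ★★★ **The defect key of the `χ₋₄∘N`-class MODULO (Δ1) for a GLOBALLY MINIMAL member `W` over a good curve `V`
with `Δ(V) < 0`** (every twist of `cm7`): as `defectKey_chi4_modulo_descent_min` with `c_∞(V) = 1` plugged in —
`v₂(q) + v₂(Tam W) + v₂(h₂) = v₂(D) + 2 + 2v₂(#W(ℚ)_tors) + v₂(μ)`.
[cite: Disegni2017, Theorem B] [cite: Pal2012, Thm. 3.2 (case d < 0)] [cite: CremonaAlgorithms1997, §3.7] -/
theorem defectKey_chi4_modulo_descent_min_of_Δ_neg (hGZ73 : GrossZagier1986_thm_I_7_3) (h2 : Module.finrank ℚ K = 2)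
    (hsplit : ((Ideal.span {(2 : ℤ)}).primesOver (𝓞 K)).ncard = 2)
    (𝔭 𝔭' : HeightOneSpectrum (𝓞 K)) (h𝔭 : ((2 : ℕ) : 𝓞 K) ∈ 𝔭.asIdeal)
    (h𝔭' : ((2 : ℕ) : 𝓞 K) ∈ 𝔭'.asIdeal)
    (κ : DirichletCharacter ℂ (NumberField.discr K).natAbs)
    (hκ : ∀ ℓ : ℕ, ℓ.Prime → ℓ ≠ 2 → κ ℓ = (jacobiSym (NumberField.discr K) ℓ : ℂ))
    (hκ2 : κ 2 = if NumberField.discr K % 8 = 1 then 1 else if NumberField.discr K % 8 = 5 then -1 else 0)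
    (hd : Nat.Coprime 2 (NumberField.discr K).natAbs)
    (V V' : WeierstrassCurve ℚ) [V.IsElliptic] [V.IsGloballyMinimal] [V'.IsElliptic] [V'.IsGloballyMinimal]
    (hΔ : V.Δ < 0)
    (hordV : IsOrdinaryAt V 2) (hordV' : IsOrdinaryAt V' 2) (hap : V'.frobeniusTrace 2 = V.frobeniusTrace 2)
    {N N' : ℕ} [NeZero N] [NeZero N'] {f : CuspForm (Gamma0 N) 2}
    {f' : CuspForm (Gamma0 N') 2} (hfV : IsNewformOf V f) (hfV' : IsNewformOf V' f')
    (hV' : ∀ n : ℕ, cuspCoeff f' n = κ (n : ZMod _) * cuspCoeff f n)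
    (h0 : PowerSeries.constantCoeff (padicLFunctionMinusBranch f (unitRoot V 2 : ℚ_[2]) 1) = 0)
    (hmod : hasEntireLFunction_rat) {M M' : ℕ} [NeZero M] [NeZero M']
    {g : CuspForm (Gamma0 M) 2} {g' : CuspForm (Gamma0 M') 2}
    (W W' : WeierstrassCurve ℚ) [W.IsElliptic] [W.IsGloballyMinimal] [W'.IsElliptic]
    (hg : IsNewformOf W g) (hg' : IsNewformOf W' g')
    (hgε : ∀ m : ℕ, cuspCoeff g m = (ZMod.χ₄.ringHomComp (Int.castRingHom ℂ)) m * cuspCoeff f m)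
    (hg'ε : ∀ m : ℕ, cuspCoeff g' m = (ZMod.χ₄.ringHomComp (Int.castRingHom ℂ)) m * cuspCoeff f' m)
    (hr : W.analyticRank = 1) (hrk : W.mordellWeilRank = 1) (hL' : W'.entireLFunction 1 ≠ 0)
    {H : Type} [Field H] [NumberField H] [Algebra K H] (hKH : Module.finrank K H = 2) {t : H}
    (htK : t ∉ Set.range (algebraMap K H)) (ht2 : t ^ 2 = algebraMap ℚ H (-1))
    (G : Subgroup (H ≃ₐ[ℚ] H)) (χ : G →* ℂˣ) (s : G → ℤ) (hs : ∀ σ, ((χ σ : ℂˣ) : ℂ) = (s σ : ℂ))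
    (τ : H ≃ₐ[ℚ] H) (hτG : τ ∈ G) (hsτ : s ⟨τ, hτG⟩ = -1)
    (hτK : ∀ a : K, τ (algebraMap K H a) = algebraMap K H a) (hτt : τ t = -t)
    {u : K} {e : ℚ} (hu : u ∉ Set.range (algebraMap ℚ K)) (hue : u ^ 2 = algebraMap ℚ K e)
    (c : K ≃ₐ[ℚ] K) (hcu : c u = -u)
    [(V.quadraticTwist (-1)).IsElliptic] {C : VariableChange ℚ} (hC : C • W = V.quadraticTwist (-1))
    {P : (V.quadraticTwist (-1)).toAffine.Point}
    (hgen : ∀ R : (V.quadraticTwist (-1)).toAffine.Point,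
      ∃ (k : ℤ) (T : (V.quadraticTwist (-1)).toAffine.Point), IsOfFinAddOrder T ∧ R = k • P + T)
    (htors : ∀ Q : ((V.quadraticTwist (-1)).quadraticTwist e).toAffine.Point, IsOfFinAddOrder Q)
    (DH : PAdicHeightDataK V 2 H)
    (hDH : ∀ (σ : G) (a b : (V.baseChange H).toAffine.Point),
      DH.pairing (pointGalHom V H σ.1 a) (pointGalHom V H σ.1 b) = DH.pairing a b)
    {h₂ : ℚ_[2]}
    (hpin : DH.pairing
      (twistPointEquivOver V (not_mem_range_rat_of_not_mem_range htK) ht2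
        (QuadraticDescent.incl H (V.quadraticTwist (-1)) P))
      (twistPointEquivOver V (not_mem_range_rat_of_not_mem_range htK) ht2
        (QuadraticDescent.incl H (V.quadraticTwist (-1)) P)) = h₂)
    (hGZ : ChiLineGrossZagierClauses ι K V H f (ι (((unitRoot V 2 : ℚ_[2]) : PadicAlgCl 2)))
      (baseChangeDirichlet K (ZMod.χ₄.ringHomComp (Int.castRingHom ℂ))) 𝔭 𝔭' G χ DH)
    {μ : ℚ} (hμ0 : μ ≠ 0) (hμ : (μ : ℝ) * V.imaginaryPeriodRat = minusPeriod f)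
    (hh₂ : h₂ ≠ 0) :
    (PowerSeries.coeff 1 (padicLFunctionMinusBranch f (unitRoot V 2 : ℚ_[2]) 1)) ≠ 0 ∧
    ∃ q : ℚ, shaAn W = (q : ℂ) ∧ q ≠ 0 ∧
      padicValRat 2 q + (padicValNat 2 W.tamagawaProduct : ℤ) + h₂.valuation =
        ((PowerSeries.coeff 1 (padicLFunctionMinusBranch f (unitRoot V 2 : ℚ_[2]) 1))).valuation + 2 +
          2 * (padicValNat 2 W.torsionOrder : ℤ) + padicValRat 2 μ := by
  obtain ⟨hD, q, hq, hq0, hv⟩ := defectKey_chi4_modulo_descent_min ι K hGZ73 h2 hsplit 𝔭 𝔭' h𝔭 h𝔭' κ hκ hκ2 hd V V'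
    hordV hordV' hap hfV hfV' hV' h0 hmod W W' hg hg' hgε hg'ε hr hrk hL' hKH htK ht2 G χ s hs τ hτG hsτ hτK hτt hu
    hue c hcu hC hgen htors DH hDH hpin hGZ hμ0 hμ hh₂
  refine ⟨hD, q, hq, hq0, ?_⟩
  rw [padicValNat_numRealComponents_eq_zero_of_Δ_neg V hΔ, Nat.cast_zero, add_zero] at hv
  exact hv

/-- ★★★ **The defect key of the `χ₋₈∘N`-class MODULO (Δ1) for a GLOBALLY MINIMAL member `W` over a good curve `V`
with `Δ(V) < 0`** (every twist of `cm7`): as `defectKey_chi8'_modulo_descent_min` with `c_∞(V) = 1` plugged in —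
`v₂(q) + v₂(Tam W) + v₂(h₂) = v₂(D) + 2 + 2v₂(#W(ℚ)_tors) + v₂(μ)`.
[cite: Disegni2017, Theorem B] [cite: Pal2012, Thm. 3.2 (case d < 0)] [cite: CremonaAlgorithms1997, §3.7] -/
theorem defectKey_chi8'_modulo_descent_min_of_Δ_neg (hGZ73 : GrossZagier1986_thm_I_7_3) (h2 : Module.finrank ℚ K = 2)
    (hsplit : ((Ideal.span {(2 : ℤ)}).primesOver (𝓞 K)).ncard = 2)
    (𝔭 𝔭' : HeightOneSpectrum (𝓞 K)) (h𝔭 : ((2 : ℕ) : 𝓞 K) ∈ 𝔭.asIdeal)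
    (h𝔭' : ((2 : ℕ) : 𝓞 K) ∈ 𝔭'.asIdeal)
    (κ : DirichletCharacter ℂ (NumberField.discr K).natAbs)
    (hκ : ∀ ℓ : ℕ, ℓ.Prime → ℓ ≠ 2 → κ ℓ = (jacobiSym (NumberField.discr K) ℓ : ℂ))
    (hκ2 : κ 2 = if NumberField.discr K % 8 = 1 then 1 else if NumberField.discr K % 8 = 5 then -1 else 0)
    (hd : Nat.Coprime 2 (NumberField.discr K).natAbs)
    (V V' : WeierstrassCurve ℚ) [V.IsElliptic] [V.IsGloballyMinimal] [V'.IsElliptic] [V'.IsGloballyMinimal]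
    (hΔ : V.Δ < 0)
    (hordV : IsOrdinaryAt V 2) (hordV' : IsOrdinaryAt V' 2) (hap : V'.frobeniusTrace 2 = V.frobeniusTrace 2)
    {N N' : ℕ} [NeZero N] [NeZero N'] {f : CuspForm (Gamma0 N) 2}
    {f' : CuspForm (Gamma0 N') 2} (hfV : IsNewformOf V f) (hfV' : IsNewformOf V' f')
    (hV' : ∀ n : ℕ, cuspCoeff f' n = κ (n : ZMod _) * cuspCoeff f n)
    (h0 : HasSum (fun k : ℕ ↦ PowerSeries.coeff k (padicLFunctionMinusBranch f (unitRoot V 2 : ℚ_[2]) 1) *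
      (-2 : ℚ_[2]) ^ k) 0)
    (hmod : hasEntireLFunction_rat) {M M' : ℕ} [NeZero M] [NeZero M']
    {g : CuspForm (Gamma0 M) 2} {g' : CuspForm (Gamma0 M') 2}
    (W W' : WeierstrassCurve ℚ) [W.IsElliptic] [W.IsGloballyMinimal] [W'.IsElliptic]
    (hg : IsNewformOf W g) (hg' : IsNewformOf W' g')
    (hgε : ∀ m : ℕ, cuspCoeff g m = (ZMod.χ₈'.ringHomComp (Int.castRingHom ℂ)) m * cuspCoeff f m)
    (hg'ε : ∀ m : ℕ, cuspCoeff g' m = (ZMod.χ₈'.ringHomComp (Int.castRingHom ℂ)) m * cuspCoeff f' m)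
    (hr : W.analyticRank = 1) (hrk : W.mordellWeilRank = 1) (hL' : W'.entireLFunction 1 ≠ 0)
    {H : Type} [Field H] [NumberField H] [Algebra K H] (hKH : Module.finrank K H = 2) {t : H}
    (htK : t ∉ Set.range (algebraMap K H)) (ht2 : t ^ 2 = algebraMap ℚ H (-2))
    (G : Subgroup (H ≃ₐ[ℚ] H)) (χ : G →* ℂˣ) (s : G → ℤ) (hs : ∀ σ, ((χ σ : ℂˣ) : ℂ) = (s σ : ℂ))
    (τ : H ≃ₐ[ℚ] H) (hτG : τ ∈ G) (hsτ : s ⟨τ, hτG⟩ = -1)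
    (hτK : ∀ a : K, τ (algebraMap K H a) = algebraMap K H a) (hτt : τ t = -t)
    {u : K} {e : ℚ} (hu : u ∉ Set.range (algebraMap ℚ K)) (hue : u ^ 2 = algebraMap ℚ K e)
    (c : K ≃ₐ[ℚ] K) (hcu : c u = -u)
    [(V.quadraticTwist (-2)).IsElliptic] {C : VariableChange ℚ} (hC : C • W = V.quadraticTwist (-2))
    {P : (V.quadraticTwist (-2)).toAffine.Point}
    (hgen : ∀ R : (V.quadraticTwist (-2)).toAffine.Point,
      ∃ (k : ℤ) (T : (V.quadraticTwist (-2)).toAffine.Point), IsOfFinAddOrder T ∧ R = k • P + T)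
    (htors : ∀ Q : ((V.quadraticTwist (-2)).quadraticTwist e).toAffine.Point, IsOfFinAddOrder Q)
    (DH : PAdicHeightDataK V 2 H)
    (hDH : ∀ (σ : G) (a b : (V.baseChange H).toAffine.Point),
      DH.pairing (pointGalHom V H σ.1 a) (pointGalHom V H σ.1 b) = DH.pairing a b)
    {h₂ : ℚ_[2]}
    (hpin : DH.pairing
      (twistPointEquivOver V (not_mem_range_rat_of_not_mem_range htK) ht2
        (QuadraticDescent.incl H (V.quadraticTwist (-2)) P))
      (twistPointEquivOver V (not_mem_range_rat_of_not_mem_range htK) ht2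
        (QuadraticDescent.incl H (V.quadraticTwist (-2)) P)) = h₂)
    (hGZ : ChiLineGrossZagierClauses ι K V H f (ι (((unitRoot V 2 : ℚ_[2]) : PadicAlgCl 2)))
      (baseChangeDirichlet K (ZMod.χ₈'.ringHomComp (Int.castRingHom ℂ))) 𝔭 𝔭' G χ DH)
    {μ : ℚ} (hμ0 : μ ≠ 0) (hμ : (μ : ℝ) * V.imaginaryPeriodRat = minusPeriod f)
    (hh₂ : h₂ ≠ 0) :
    (∑' k : ℕ, PowerSeries.coeff k
        (padicLFunctionMinusBranch f (unitRoot V 2 : ℚ_[2]) 1) * (k : ℚ_[2]) * (-2) ^ (k - 1)) ≠ 0 ∧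
    ∃ q : ℚ, shaAn W = (q : ℂ) ∧ q ≠ 0 ∧
      padicValRat 2 q + (padicValNat 2 W.tamagawaProduct : ℤ) + h₂.valuation =
        ((∑' k : ℕ, PowerSeries.coeff k
        (padicLFunctionMinusBranch f (unitRoot V 2 : ℚ_[2]) 1) * (k : ℚ_[2]) * (-2) ^ (k - 1))).valuation + 2 +
          2 * (padicValNat 2 W.torsionOrder : ℤ) + padicValRat 2 μ := by
  obtain ⟨hD, q, hq, hq0, hv⟩ := defectKey_chi8'_modulo_descent_min ι K hGZ73 h2 hsplit 𝔭 𝔭' h𝔭 h𝔭' κ hκ hκ2 hd V V'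
    hordV hordV' hap hfV hfV' hV' h0 hmod W W' hg hg' hgε hg'ε hr hrk hL' hKH htK ht2 G χ s hs τ hτG hsτ hτK hτt hu
    hue c hcu hC hgen htors DH hDH hpin hGZ hμ0 hμ hh₂
  refine ⟨hD, q, hq, hq0, ?_⟩
  rw [padicValNat_numRealComponents_eq_zero_of_Δ_neg V hΔ, Nat.cast_zero, add_zero] at hv
  exact hv

end Summit.BirchSwinnertonDyer.BirchSwinnertonDyer.Theorems.PrintCf2.DisegniPairTwo

end
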